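import Literature.AnabelianGeometry.SemiGraphs.TemperedFixedEdgesParallel
import Literature.AnabelianGeometry.SemiGraphs.TreeFixedLocusBounce
import HarnessLib

/-!
# [SemiAnbd] Thm 3.7 (iii) beyond finite `𝔾`: over a persistent finite-valence vertex the fixed loci BOUNCE

Mochizuki, *Semi-graphs of anabelioids*, Publ. RIMS **42** (2006) [MochizukiSemiAnbd2006], §3,
Theorem 3.7 (iii) pp. 40–41, proof p. 41 (the sub-joint argument, Lemma 1.8 (ii)(b)) with the author's
*Comments* (2020) (6)(b) [cite: MochizukiSemiAnbd2006, Thm 3.7(iii) p.41].  Printed proof = finite `𝔾`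
(kernel `compactInVerticialAt_of_finiteGraph`, p431007); the ∀-countable typing is refuted (p442260) by escape
along an END.

CHARACTERISATION COROLLARY (abc-iut cell, L3, G2 characterisation lane; seat abc-iut-L3-t8 gen 5, memo
HOME/staging/L3/L3-t8/g5/G2-CHARACTERISATION-L3t8g5.md (C1); PROOF-ONLY, 0 definitions): assembling
`eventually_sameBranch_of_fixed_tree_temperedPiChart` (no branching across two branches of `𝔾` at a
finite-valence vertex, from some level on) at a vertex `v` AND at its finitely many neighbours with the
combinatorial bounce `SemiGraph.exists_base_eq_or_eq_of_fixed`: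

* `ProfiniteSemiGraph.finite_neighbours_of_finite_branches` — a vertex with finitely many branches has finitely
  many neighbours;
* **`ProfiniteSemiGraph.eventually_fixedLocus_over_edge_temperedPiChart`** — for a countable `𝒢` with the
  hypotheses of Thm. 3.7, a nontrivial compact `C ≤ π₁^temp(𝒢)`, and a vertex `v` of finite valence all of
  whose neighbours have finite valence: from some level on, IF the `C`-fixed locus of `𝔾̃_n` has a vertex
  over `v`, THEN every `C`-fixed vertex of `𝔾̃_n` lies over `v` or over ONE neighbour of `v` — the base image
  of the level-`n` fixed locus is contained in one closed edge at `v` («bouncing»; drift pairs only).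

Reading (memo (C2)): at locally finite `𝔾`, a nontrivial compact subgroup whose fixed loci keep a vertex over
`v` at every level has, eventually, fixed loci over a finite sub-semi-graph — «vertical escape» does not
occur; the failure of the ∀-countable statement is horizontal (along an end).  Nothing here bears on
[IUTchIII] Cor. 3.12.
-/

namespace Literature.AnabelianGeometry.SemiGraphs

namespace ProfiniteSemiGraph

open CategoryTheory Topology

universe u

variable (𝒢 : ProfiniteSemiGraph.{u})

/-- A vertex with finitely many branches has finitely many neighbours (vertices joined to it by an edge):
the neighbour across the edge of a branch `b` at `v` is the abutment of the OTHER branch of that edge.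
[cite: MochizukiSemiAnbd2006, §1 p.11] -/
theorem finite_neighbours_of_finite_branches (v : 𝒢.graph.Vertex)
    (hv : {b : 𝒢.graph.Branch | 𝒢.graph.abuts b = some v}.Finite) :
    {u : 𝒢.graph.Vertex | ∃ b b' : 𝒢.graph.Branch, b ≠ b' ∧ 𝒢.graph.edgeOf b = 𝒢.graph.edgeOf b' ∧
      𝒢.graph.abuts b = some v ∧ 𝒢.graph.abuts b' = some u}.Finite := by
  classical
  -- the other branch of the edge of `b`
  have hoth : ∀ b : 𝒢.graph.Branch, ∃ b' : 𝒢.graph.Branch, b' ≠ b ∧ 𝒢.graph.edgeOf b' = 𝒢.graph.edgeOf b ∧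
      ∀ b'' : 𝒢.graph.Branch, b'' ≠ b → 𝒢.graph.edgeOf b'' = 𝒢.graph.edgeOf b → b'' = b' := by
    intro b
    obtain ⟨b₁, b₂, h12, h₁, h₂, hall⟩ := 𝒢.graph.two_branches (𝒢.graph.edgeOf b)
    rcases hall b rfl with hb | hb
    · refine ⟨b₂, fun h => h12.symm (h.trans hb), h₂, fun b'' hne he => ?_⟩
      rcases hall b'' he with h | h
      · exact absurd (h.trans hb.symm) hne
      · exact h
    · refine ⟨b₁, fun h => h12 (h.trans hb), h₁, fun b'' hne he => ?_⟩
      rcases hall b'' he with h | h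
      · exact h
      · exact absurd (h.trans hb.symm) hne
  choose oth hoth_ne hoth_e hoth_uniq using hoth
  refine (hv.image fun b => (𝒢.graph.abuts (oth b)).getD v).subset ?_
  rintro u ⟨b, b', hbb', he, hb, hb'⟩
  refine ⟨b, hb, ?_⟩
  have h1 : b' = oth b := hoth_uniq b b' (fun h => hbb' h.symm) he.symm
  change (𝒢.graph.abuts (oth b)).getD v = u
  rw [← h1, hb']
  rfl

/-- **Over a persistent finite-valence vertex the fixed loci bounce over one closed edge.**  Let `𝒢` satisfy
the hypotheses of Thm. 3.7, `C ≤ π₁^temp(𝒢)` (canonical chart) be compact and nontrivial, and `v` a vertex of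
`𝔾` with finitely many branches all of whose neighbours have finitely many branches.  Then there is a level
`n₀` such that for every `n ≥ n₀`: if some `C`-fixed vertex `x` of the tree `𝔾̃_n` lies over `v`, then there
is a vertex `u` of `𝔾` (joined to `v`, or `v` itself) such that EVERY `C`-fixed vertex of `𝔾̃_n` lies over
`v` or over `u`. [cite: MochizukiSemiAnbd2006, Thm 3.7(iii) p.41] -/
theorem eventually_fixedLocus_over_edge_temperedPiChart (h37 : 𝒢.Thm37Hypotheses)
    (C : Subgroup (𝒢.temperedPiChart h37.toProp36Hypotheses).G)
    (hCcpt : IsCompact (C : Set (𝒢.temperedPiChart h37.toProp36Hypotheses).G)) (hC : C ≠ ⊥)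
    (v : 𝒢.graph.Vertex) (hv : {b : 𝒢.graph.Branch | 𝒢.graph.abuts b = some v}.Finite)
    (hnb : ∀ u : 𝒢.graph.Vertex, (∃ b b' : 𝒢.graph.Branch, b ≠ b' ∧ 𝒢.graph.edgeOf b = 𝒢.graph.edgeOf b' ∧
      𝒢.graph.abuts b = some v ∧ 𝒢.graph.abuts b' = some u) →
      {b : 𝒢.graph.Branch | 𝒢.graph.abuts b = some u}.Finite) :
    ∃ n₀ : ℕ, ∀ n, n₀ ≤ n →
      ∀ x : ((𝒢.galoisLevelData h37.toProp36Hypotheses).tree n).Vertex,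
        ((𝒢.galoisLevelData h37.toProp36Hypotheses).treeProj n).vertexMap x = v →
        (∀ γ ∈ C, ((𝒢.galoisLevelData h37.toProp36Hypotheses).treeAct h37.toProp36Hypotheses.isCountable
          n γ).hom.vertexMap x = x) →
        ∃ u : 𝒢.graph.Vertex, ∀ y : ((𝒢.galoisLevelData h37.toProp36Hypotheses).tree n).Vertex,
          (∀ γ ∈ C, ((𝒢.galoisLevelData h37.toProp36Hypotheses).treeAct h37.toProp36Hypotheses.isCountable
            n γ).hom.vertexMap y = y) →
          ((𝒢.galoisLevelData h37.toProp36Hypotheses).treeProj n).vertexMap y = v ∨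
            ((𝒢.galoisLevelData h37.toProp36Hypotheses).treeProj n).vertexMap y = u := by
  classical
  set D := 𝒢.galoisLevelData h37.toProp36Hypotheses with hD
  -- the finite set of relevant base vertices: `v` and its neighbours
  let N : Set 𝒢.graph.Vertex := {u | ∃ b b' : 𝒢.graph.Branch, b ≠ b' ∧
    𝒢.graph.edgeOf b = 𝒢.graph.edgeOf b' ∧ 𝒢.graph.abuts b = some v ∧ 𝒢.graph.abuts b' = some u}
  have hN : N.Finite := 𝒢.finite_neighbours_of_finite_branches v hv
  have hrel : ∀ u : 𝒢.graph.Vertex, (u = v ∨ u ∈ N) → ∃ n₀ : ℕ, ∀ n, n₀ ≤ n →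
      ∀ (z : (D.tree n).Vertex) (β β' : (D.tree n).Branch), (D.treeProj n).vertexMap z = u →
      (D.tree n).abuts β = some z → (D.tree n).abuts β' = some z →
      (∀ γ ∈ C, (D.treeAct h37.toProp36Hypotheses.isCountable n γ).hom.branchMap β = β) →
      (∀ γ ∈ C, (D.treeAct h37.toProp36Hypotheses.isCountable n γ).hom.branchMap β' = β') →
      (D.treeProj n).branchMap β = (D.treeProj n).branchMap β' := by
    intro u hu
    have hfin : {b : 𝒢.graph.Branch | 𝒢.graph.abuts b = some u}.Finite := by
      rcases hu with rfl | hu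
      · exact hv
      · exact hnb u hu
    exact 𝒢.eventually_sameBranch_of_fixed_tree_temperedPiChart h37 C hCcpt hC u hfin
  choose! n₀ hn₀ using hrel
  refine ⟨max (n₀ v) (hN.toFinset.sup n₀), fun n hn x hx hfx => ?_⟩
  -- the level-`n` automorphisms through which `C` acts
  let S : Set (Aut (D.tree n)) :=
    (fun γ : (𝒢.temperedPiChart h37.toProp36Hypotheses).G => D.treeAct h37.toProp36Hypotheses.isCountable n γ) ''
      (C : Set (𝒢.temperedPiChart h37.toProp36Hypotheses).G)
  -- the single-type hypothesis at level `n`, at every tree vertex over `v` or a neighbour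
  have hsame : ∀ z : (D.tree n).Vertex, ((D.treeProj n).vertexMap z = v ∨ ∃ b b' : 𝒢.graph.Branch,
        b ≠ b' ∧ 𝒢.graph.edgeOf b = 𝒢.graph.edgeOf b' ∧ 𝒢.graph.abuts b = some v ∧
        𝒢.graph.abuts b' = some ((D.treeProj n).vertexMap z)) →
      ∀ β β' : (D.tree n).Branch, (D.tree n).abuts β = some z → (D.tree n).abuts β' = some z →
        (∀ σ ∈ S, σ.hom.branchMap β = β) → (∀ σ ∈ S, σ.hom.branchMap β' = β') →
        (D.treeProj n).branchMap β = (D.treeProj n).branchMap β' := by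
    intro z hz β β' hβ hβ' hfβ hfβ'
    have hfβC : ∀ γ ∈ C, (D.treeAct h37.toProp36Hypotheses.isCountable n γ).hom.branchMap β = β :=
      fun γ hγ => hfβ _ ⟨γ, hγ, rfl⟩
    have hfβ'C : ∀ γ ∈ C, (D.treeAct h37.toProp36Hypotheses.isCountable n γ).hom.branchMap β' = β' :=
      fun γ hγ => hfβ' _ ⟨γ, hγ, rfl⟩
    rcases hz with hz | hz
    · exact hn₀ v (Or.inl rfl) n ((le_max_left _ _).trans hn) z β β' hz hβ hβ' hfβC hfβ'C
    · have hmem : (D.treeProj n).vertexMap z ∈ N := hz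
      have hle : n₀ ((D.treeProj n).vertexMap z) ≤ n :=
        ((Finset.le_sup (hN.mem_toFinset.mpr hmem)).trans (le_max_right _ _)).trans hn
      exact hn₀ _ (Or.inr hmem) n hle z β β' rfl hβ hβ' hfβC hfβ'C
  obtain ⟨u, hu⟩ := SemiGraph.exists_base_eq_or_eq_of_fixed (D.isTree_tree n) (D.treeProj n) S v hsame x hx
    (by rintro σ ⟨γ, hγ, rfl⟩; exact hfx γ hγ)
  exact ⟨u, fun y hy => hu y (by rintro σ ⟨γ, hγ, rfl⟩; exact hy γ hγ)⟩

/-- **The same with the second base vertex located** (over `v` and ONE vertex joined to `v` by an edge of `𝔾`,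
or over `v` alone): from some level on, if the `C`-fixed locus of `𝔾̃_n` meets the fibre over the
finite-valence vertex `v` (with finite-valence neighbours), its base image lies in one closed edge at `v`.
[cite: MochizukiSemiAnbd2006, Thm 3.7(iii) p.41] -/
theorem eventually_fixedLocus_over_closedEdge_temperedPiChart (h37 : 𝒢.Thm37Hypotheses)
    (C : Subgroup (𝒢.temperedPiChart h37.toProp36Hypotheses).G)
    (hCcpt : IsCompact (C : Set (𝒢.temperedPiChart h37.toProp36Hypotheses).G)) (hC : C ≠ ⊥)
    (v : 𝒢.graph.Vertex) (hv : {b : 𝒢.graph.Branch | 𝒢.graph.abuts b = some v}.Finite)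
    (hnb : ∀ u : 𝒢.graph.Vertex, (∃ b b' : 𝒢.graph.Branch, b ≠ b' ∧ 𝒢.graph.edgeOf b = 𝒢.graph.edgeOf b' ∧
      𝒢.graph.abuts b = some v ∧ 𝒢.graph.abuts b' = some u) →
      {b : 𝒢.graph.Branch | 𝒢.graph.abuts b = some u}.Finite) :
    ∃ n₀ : ℕ, ∀ n, n₀ ≤ n →
      ∀ x : ((𝒢.galoisLevelData h37.toProp36Hypotheses).tree n).Vertex,
        ((𝒢.galoisLevelData h37.toProp36Hypotheses).treeProj n).vertexMap x = v →
        (∀ γ ∈ C, ((𝒢.galoisLevelData h37.toProp36Hypotheses).treeAct h37.toProp36Hypotheses.isCountable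
          n γ).hom.vertexMap x = x) →
        ∃ u : 𝒢.graph.Vertex, (u = v ∨ ∃ b b' : 𝒢.graph.Branch, b ≠ b' ∧
            𝒢.graph.edgeOf b = 𝒢.graph.edgeOf b' ∧ 𝒢.graph.abuts b = some v ∧ 𝒢.graph.abuts b' = some u) ∧
          ∀ y : ((𝒢.galoisLevelData h37.toProp36Hypotheses).tree n).Vertex,
          (∀ γ ∈ C, ((𝒢.galoisLevelData h37.toProp36Hypotheses).treeAct h37.toProp36Hypotheses.isCountable
            n γ).hom.vertexMap y = y) →
          ((𝒢.galoisLevelData h37.toProp36Hypotheses).treeProj n).vertexMap y = v ∨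
            ((𝒢.galoisLevelData h37.toProp36Hypotheses).treeProj n).vertexMap y = u := by
  classical
  set D := 𝒢.galoisLevelData h37.toProp36Hypotheses with hD
  let N : Set 𝒢.graph.Vertex := {u | ∃ b b' : 𝒢.graph.Branch, b ≠ b' ∧
    𝒢.graph.edgeOf b = 𝒢.graph.edgeOf b' ∧ 𝒢.graph.abuts b = some v ∧ 𝒢.graph.abuts b' = some u}
  have hN : N.Finite := 𝒢.finite_neighbours_of_finite_branches v hv
  have hrel : ∀ u : 𝒢.graph.Vertex, (u = v ∨ u ∈ N) → ∃ n₀ : ℕ, ∀ n, n₀ ≤ n →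
      ∀ (z : (D.tree n).Vertex) (β β' : (D.tree n).Branch), (D.treeProj n).vertexMap z = u →
      (D.tree n).abuts β = some z → (D.tree n).abuts β' = some z →
      (∀ γ ∈ C, (D.treeAct h37.toProp36Hypotheses.isCountable n γ).hom.branchMap β = β) →
      (∀ γ ∈ C, (D.treeAct h37.toProp36Hypotheses.isCountable n γ).hom.branchMap β' = β') →
      (D.treeProj n).branchMap β = (D.treeProj n).branchMap β' := by
    intro u hu
    have hfin : {b : 𝒢.graph.Branch | 𝒢.graph.abuts b = some u}.Finite := by
      rcases hu with rfl | hu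
      · exact hv
      · exact hnb u hu
    exact 𝒢.eventually_sameBranch_of_fixed_tree_temperedPiChart h37 C hCcpt hC u hfin
  choose! n₀ hn₀ using hrel
  refine ⟨max (n₀ v) (hN.toFinset.sup n₀), fun n hn x hx hfx => ?_⟩
  let S : Set (Aut (D.tree n)) :=
    (fun γ : (𝒢.temperedPiChart h37.toProp36Hypotheses).G => D.treeAct h37.toProp36Hypotheses.isCountable n γ) ''
      (C : Set (𝒢.temperedPiChart h37.toProp36Hypotheses).G)
  have hsame : ∀ z : (D.tree n).Vertex, ((D.treeProj n).vertexMap z = v ∨ ∃ b b' : 𝒢.graph.Branch,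
        b ≠ b' ∧ 𝒢.graph.edgeOf b = 𝒢.graph.edgeOf b' ∧ 𝒢.graph.abuts b = some v ∧
        𝒢.graph.abuts b' = some ((D.treeProj n).vertexMap z)) →
      ∀ β β' : (D.tree n).Branch, (D.tree n).abuts β = some z → (D.tree n).abuts β' = some z →
        (∀ σ ∈ S, σ.hom.branchMap β = β) → (∀ σ ∈ S, σ.hom.branchMap β' = β') →
        (D.treeProj n).branchMap β = (D.treeProj n).branchMap β' := by
    intro z hz β β' hβ hβ' hfβ hfβ'
    have hfβC : ∀ γ ∈ C, (D.treeAct h37.toProp36Hypotheses.isCountable n γ).hom.branchMap β = β :=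
      fun γ hγ => hfβ _ ⟨γ, hγ, rfl⟩
    have hfβ'C : ∀ γ ∈ C, (D.treeAct h37.toProp36Hypotheses.isCountable n γ).hom.branchMap β' = β' :=
      fun γ hγ => hfβ' _ ⟨γ, hγ, rfl⟩
    rcases hz with hz | hz
    · exact hn₀ v (Or.inl rfl) n ((le_max_left _ _).trans hn) z β β' hz hβ hβ' hfβC hfβ'C
    · have hmem : (D.treeProj n).vertexMap z ∈ N := hz
      have hle : n₀ ((D.treeProj n).vertexMap z) ≤ n :=
        ((Finset.le_sup (hN.mem_toFinset.mpr hmem)).trans (le_max_right _ _)).trans hn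
      exact hn₀ _ (Or.inr hmem) n hle z β β' rfl hβ hβ' hfβC hfβ'C
  obtain ⟨u, hadj, hu⟩ := SemiGraph.exists_base_eq_or_adj_of_fixed (D.isTree_tree n) (D.treeProj n) S v
    hsame x hx (by rintro σ ⟨γ, hγ, rfl⟩; exact hfx γ hγ)
  exact ⟨u, hadj, fun y hy => hu y (by rintro σ ⟨γ, hγ, rfl⟩; exact hy γ hγ)⟩

end ProfiniteSemiGraph

end Literature.AnabelianGeometry.SemiGraphs
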